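import Summits.BirchSwinnertonDyer.BirchSwinnertonDyer.Theses.GenusKolyvaginAtTwo
import Summits.BirchSwinnertonDyer.BirchSwinnertonDyer.Theorems.TwoAdicConverseRankOneTwoConverseOfConjAOfProp37
import HarnessLib

/-!
# SKELETON LINE `conjA_prop37_byname` for item 19220 `RankOneTwoConverse`
# (route GenusKolyvaginAtTwo, support r202 — the corank-1 2-CONVERSE on the (good ordinary ∨ multiplicative)-at-2,
#  non-CM class; the decl is shared VERBATIM with route `TwoAdicConverse` (S3), where it is crux r4)

line-writer skeleton (linewriter-bsd-genuskolyattwo-1 g1, SECOND VARIANT — the line of record registered by g0 is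
`Lines/heegner_field_road.lean`, sha 3492123dcd5f3156, untouched). NOT leaf progress; nothing here proves any item.

THE LINE (Kolyvagin road, by name from FOUR EXISTING ITEMS). The tree already holds the landed conditional theorem
`Summit.BirchSwinnertonDyer.BirchSwinnertonDyer.Theorems.TwoAdicConverseOfConjA.rankOneTwoConverse_of_conjA_of_prop37`
(file `Theorems/TwoAdicConverseRankOneTwoConverseOfConjAOfProp37.lean`):

  U1 (28083) → Gross Prop. 3.7 (2) (23091) → off-big-image residual (24404) → printed inputs (23951)
    → `Theses.TwoAdicConverse.RankOneTwoConverse`,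

i.e. the r = 1 branch of route `KolyvaginRankRigidityAtTwo`'s deciding theorem replayed at p = 2: 2-parity
(Dokchitser–Dokchitser) ⇒ w(E) = −1; a Hoffstein–Luo Heegner field K with 2 split, d_K ≡ 1 (mod 8) and L(E^(d_K),1) ≠ 0;
Kato–Kolyvagin ⇒ Sel_{2^∞}(E^(d_K)) finite; Kolyvagin's Conjecture A at 2 (U1: some Kolyvagin class c_M(n) ≠ 0, with the
RICH depth bookkeeping of KRR2) plus the landed rich lower bound V2♭∞ (`KolyvaginCorankLowerBoundAtTwoRich_of_prop37`,
proved modulo the single print fact Gross 1991 Prop. 3.7 (2)) force the least rich depth ν = 0, i.e. the Heegner point y_K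
is non-torsion; Gross–Zagier + L(E/K) = L(E)·L(E^(d_K)) give ord_{s=1} L(E,s) = 1. On the non-big-image locus
(some ρ̄_{E,2^m} not surjective) the statement is the declared residual 24404.

Since `Theses.GenusKolyvaginAtTwo.RankOneTwoConverse` and `Theses.TwoAdicConverse.RankOneTwoConverse` have the SAME body
(`∀ W, [IsElliptic] → [IsGloballyMinimal] → ¬HasCM → (GoodOrd W 2 ∨ Mult W 2) → selmerCorank 2 = 1 → analyticRank = 1`),
the composition below is a definitional transport (`Iff.rfl`), and the four stubs are the four items BY NAME:

* `stub_conjA`         — RESEARCH (XL): item 28083 `KolyvaginRankRigidityAtTwo.KolyvaginBoundedDefectAtTwo` (Kolyvagin's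
                         Conjecture A at p = 2 in the tree's frame; KRR2 crux r201, LEAD skeleton `kolyvagin_swap_v72r` registered
                         on `Cruxes/KolyvaginBoundedDefectAtTwo/`). This is the ONE research stub of the line.
* `stub_prop37`        — PRINT (S): item 23091 `KolyvaginRankRigidityAtTwo.Prop37FrobeniusCongruenceAtTwo`
                         (:= `Literature.NumberTheory.EllipticCurves.GrossLMS1991.prop37_2_frobeniusCongruence`)
                         [Gross, "Kolyvagin's work on modular elliptic curves", LMS LN 153 (1991), Prop. 3.7 (2)].
* `stub_offBigImage`   — RESIDUAL (declared open problem): item 24404 `TwoAdicConverse.RankOneTwoConverseOffBigImage`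
                         (the corank-1 2-converse when some ρ̄_{E,2^m} is not surjective; no printed engine).
* `stub_printedInputs` — PRINT (M, provable-now from Literature facts): item 23951 `TwoAdicConverse.PrintedInputsRankOneAtTwo`
                         (modularity, Hoffstein–Luo, 2-parity DD 2010 Thm 1.4, Kato–Kolyvagin finiteness, L(E/K) factorisation,
                         Gross–Zagier at all levels, Heegner-system record).

WHY THIS VARIANT (vs. the line of record `heegner_field_road`): the g0 road isolates the 2-adic hole as "Heegner point
non-torsion from 2-Selmer corank one over K" per reduction cell — an over-K 2-converse with NO printed engine (BDP / Heegner
main conjecture are p odd; Zhang needs p ≥ 5), i.e. its research stubs are as strong as the item on each cell. This variant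
routes through the tree's OWN Kolyvagin-system machinery at p = 2 (routes KRR2 / S3, ≈ 30 landed theorems) and shows that the
open content of 19220 is EXACTLY {U1 28083 (research), 24404 (residual)} + two print items — hands belong on U1's registered
LEAD line, not on a fresh over-K converse. Honest: U1 at p = 2 is itself open (Kolyvagin 1991 Conj. A is stated for all p but
proved nowhere at p = 2); the residual 24404 has no line.

REJECTED ALTERNATIVE (recorded so nobody re-walks it): a "congruence-transfer" road (Kriz–Li mod-2 Heegner-log congruences,
supplying Assumption (★) from a congruent partner curve) — the KL congruence is an equivalence inside the mod-2 class, so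
"(★) on a partner" ⟺ (★) on E (unit Heegner log), which FAILS whenever the Heegner index is even: costume, not a line.

References: [cite: Kolyvagin1991MathAnn, §2 Conj. A, Thm. 2.2–2.3] [cite: GrossLMS1991, Prop. 3.7 (2)] [cite: WZhang2014, Thm. 1.1]
[cite: GrossZagier1986, I (6.1)] [cite: HoffsteinLuo1997, Thm. 1] [cite: DokchitserDokchitser2010, Thm. 1.4] [cite: KrizLi2019, Thm. 1.1].
-/

set_option autoImplicit false
-- the Cruxes namespace of this sub repeats the summit name by design (D-0017 nested layout)
set_option linter.dupNamespace false

noncomputable section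

open Summit.BirchSwinnertonDyer.BirchSwinnertonDyer.Theses

namespace Summit.BirchSwinnertonDyer.BirchSwinnertonDyer.Cruxes.RankOneTwoConverse.ConjAProp37ByName

/-- **stub (RESEARCH, XL) = item 28083 BY NAME**: Kolyvagin's Conjecture A at p = 2 in the tree's frame
(`KolyvaginRankRigidityAtTwo.KolyvaginBoundedDefectAtTwo`, KRR2 crux U1; LEAD line `kolyvagin_swap_v72r`).
[cite: Kolyvagin1991MathAnn, §2 Conj. A] -/
theorem stub_conjA : KolyvaginRankRigidityAtTwo.KolyvaginBoundedDefectAtTwo := by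
  sorry

/-- **stub (PRINT, S) = item 23091 BY NAME** (`KolyvaginRankRigidityAtTwo.Prop37FrobeniusCongruenceAtTwo :=
GrossLMS1991.prop37_2_frobeniusCongruence`): Gross 1991 Prop. 3.7 (2), the Frobenius congruence y_n ≡ Frob_ℓ y_m (mod λ_n)
for Heegner points at Kolyvagin primes (image-free). [cite: GrossLMS1991, Prop. 3.7 (2)] [cite: Nekovar2007, Prop. 4.9] -/
theorem stub_prop37 : KolyvaginRankRigidityAtTwo.Prop37FrobeniusCongruenceAtTwo := by
  sorry

/-- **stub (RESIDUAL, declared open problem) = item 24404 BY NAME**: the corank-1 2-converse off the big-image locus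
(some ρ̄_{E,2^m} not surjective). No printed engine; carried as the route's residual. -/
theorem stub_offBigImage : TwoAdicConverse.RankOneTwoConverseOffBigImage := by
  sorry

/-- **stub (PRINT, M; provable now from Literature facts) = item 23951 BY NAME**: the printed inputs of the r = 1 branch
(modularity; Hoffstein–Luo; 2-parity; Kato–Kolyvagin finiteness; L(E/K) = L(E)·L(E^(d)); Gross–Zagier all levels; Heegner-system
record). [cite: HoffsteinLuo1997, Thm. 1] [cite: DokchitserDokchitser2010, Thm. 1.4] [cite: GrossZagier1986, I (6.1)] -/
theorem stub_printedInputs : TwoAdicConverse.PrintedInputsRankOneAtTwo := by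
  sorry

/-- The two route decls `GenusKolyvaginAtTwo.RankOneTwoConverse` (19220 on this route) and
`TwoAdicConverse.RankOneTwoConverse` (19220 on S3) have the same body: definitional `Iff`. -/
theorem rankOneTwoConverse_iff_twoAdicConverse :
    GenusKolyvaginAtTwo.RankOneTwoConverse ↔ TwoAdicConverse.RankOneTwoConverse :=
  Iff.rfl

/-- **Composition (kernel-checked, no sorry outside the four stubs)**: item 19220 `GenusKolyvaginAtTwo.RankOneTwoConverse`
BY NAME from the four stubs, through the landed `rankOneTwoConverse_of_conjA_of_prop37`. -/
theorem RankOneTwoConverse_of : GenusKolyvaginAtTwo.RankOneTwoConverse :=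
  rankOneTwoConverse_iff_twoAdicConverse.mpr
    (Theorems.TwoAdicConverseOfConjA.rankOneTwoConverse_of_conjA_of_prop37
      stub_conjA (show Literature.NumberTheory.EllipticCurves.GrossLMS1991.prop37_2_frobeniusCongruence from stub_prop37)
      stub_offBigImage stub_printedInputs)

end Summit.BirchSwinnertonDyer.BirchSwinnertonDyer.Cruxes.RankOneTwoConverse.ConjAProp37ByName

end
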